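import Summits.AtomisticToContinuum.Crystallization.Theorems.FrustratedLawDichotomyStrainedPatchHomForceCentredSound

/-!
# (C′-2) FORCE/EXEMPT PRUNE, centred form — soundness II: the per-label dispatchers `contribA` / `contribB`
# (27623 strained-patch piece, hcp half; decomp-a2c hand-2 g28)

* §1 case equations of the dispatchers (`contribA_far/zero/out/near/naive`, `contribB_far/out/near/naive`) — by `unfold`/`extract_lets`/`rw` only
  (the kernel terms must never be weak-head normalised by the elaborator);
* §2–§3 shared facts and ★★ `contribA_sound` (the `B` twin `contribB_sound` is the sequel `…HomForceCentredLeafB`) — for EVERY label `b`: if the dispatcher's guard holds there are signed coefficients `κ` (entries) and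
  `σ` (gradient) inside its `K`/`S` intervals with `cutSlope(v_b)·SC ≤ val + nv + rem/2 + SC·Λ κ σ`, `Λ` the family's first-order functional in the
  twelve box coordinates (`Λ_A κ σ = Σ_ac Δu_ac κ_ac`; `Λ_B` adds `Σ_i Δξ_i Σ_a u⁰_ai σ_a + Σ_ai Δu_ai Δξ_i σ_a`).  Far labels (integer pretest,
  `‖U q‖ ≥ ¾‖q‖`), the zero label and certainly-out labels contribute nothing; near labels use `…Sound.nearContrib_sound` with the centre map `U₀`
  and the displacement identity `v − v⁰ = (U − U₀)q (+ U₀Δξ + (U − U₀)Δξ)`; the rest use the v1 bound `…HomForceSum.cutSlope_le_termHi`.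
NO definitions; 0 sorry; axioms standard.  `--supports stmt-AtomisticToContinuum-27623`.
-/

namespace Summit.AtomisticToContinuum.Crystallization.Theorems.FrustratedLawDichotomyStrainedPatchHomForceCentredLeaf

open scoped BigOperators RealInnerProductSpace
open Literature.Analysis.ValidatedNumerics.Numerics
open Summit.AtomisticToContinuum.Crystallization.Theorems.ChargedEnergyGapNegative (E3)
open Summit.AtomisticToContinuum.Crystallization.Theorems.FrustratedLawDichotomyStrainedPatchHomSplit (latPt hexFrame hcpShift)
open Summit.AtomisticToContinuum.Crystallization.Theorems.FrustratedLawDichotomyStrainedPatchHomCoords (apply_eq_sum_entries)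
open Summit.AtomisticToContinuum.Crystallization.Theorems.FrustratedLawDichotomyStrainedPatchHomLatticeBox (norm_apply_ge_of_near_one latPt_zero)
open Summit.AtomisticToContinuum.Crystallization.Theorems.FrustratedLawDichotomyStrainedPatchHomLatticeBoxHcp
  (latPt_eq_apply_one norm_sq_hexPt norm_sq_hexPt_add_shift latPt_hex_injective shifted_eq_apply norm_shifted_gt)
open Summit.AtomisticToContinuum.Crystallization.Theorems.FrustratedLawDichotomyStrainedPatchHomEntryGram (entryFI mem_entryFI)
open Summit.AtomisticToContinuum.Crystallization.Theorems.FrustratedLawDichotomyStrainedPatchHomEntryGramHcp (dot3 mem_dot3 shufFI mem_shufFI)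
open Summit.AtomisticToContinuum.Crystallization.Theorems.FrustratedLawDichotomyStrainedPatchHomForceKit
open Summit.AtomisticToContinuum.Crystallization.Theorems.FrustratedLawDichotomyStrainedPatchHomForceSum (cutSlope closedForm_eq_kernel termHi cutSlope_le_termHi)
open Summit.AtomisticToContinuum.Crystallization.Theorems.FrustratedLawDichotomyStrainedPatchHomForceCentred
open Summit.AtomisticToContinuum.Crystallization.Theorems.FrustratedLawDichotomyStrainedPatchHomForceCentredSound

/-! ## §1. Case equations of the dispatchers -/

section caseEqs
variable {en : Fin 3 → ℤ} {ed : ℕ} {sn : ℤ} {sd : ℕ} {c w : (Fin 3 × Fin 3) ⊕ Fin 3 → ℤ} {E E0 : Fin 3 × Fin 3 → FI} {X X0 : Fin 3 → FI}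
  {b : Fin 3 → ℤ}

/-- [formal bookkeeping] -/
theorem contribA_far (h : farA b = true) : contribA en ed sn sd w E E0 b = Acc.zero := by
  unfold contribA; rw [h]

/-- [formal bookkeeping] -/
theorem contribA_zero (h1 : farA b = false) (h2 : decide (b = 0) = true) : contribA en ed sn sd w E E0 b = Acc.zero := by
  unfold contribA; rw [h1, h2]

/-- [formal bookkeeping] -/
theorem contribA_out (h1 : farA b = false) (h2 : decide (b = 0) = false) (h3 : decide (49 * (SC : ℤ) < (dot3 (vecA E b) (vecA E b)).lo) = true) :
    contribA en ed sn sd w E E0 b = Acc.zero := by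
  unfold contribA; extract_lets V; rw [h1, h2, h3]

/-- [formal bookkeeping] -/
theorem contribA_near (h1 : farA b = false) (h2 : decide (b = 0) = false) (h3 : decide (49 * (SC : ℤ) < (dot3 (vecA E b) (vecA E b)).lo) = false)
    (h4 : decide ((dot3 (vecA E b) (vecA E b)).hi ≤ near2) = true) :
    contribA en ed sn sd w E E0 b = nearContrib en ed sn sd (vecA E0 b) (vecA eId b) (dA w (vecA eId b)) := by
  unfold contribA; extract_lets V; rw [h1, h2, h3, h4]

/-- [formal bookkeeping] -/
theorem contribA_naive (h1 : farA b = false) (h2 : decide (b = 0) = false) (h3 : decide (49 * (SC : ℤ) < (dot3 (vecA E b) (vecA E b)).lo) = false)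
    (h4 : decide ((dot3 (vecA E b) (vecA E b)).hi ≤ near2) = false) :
    contribA en ed sn sd w E E0 b = naiveContrib (termHi en ed sn sd false (vecA E b)) := by
  unfold contribA; extract_lets V; rw [h1, h2, h3, h4]

/-- [formal bookkeeping] -/
theorem contribB_far (h : farB b = true) : contribB en ed sn sd c w E E0 X X0 b = Acc.zero := by
  unfold contribB; rw [h]

/-- [formal bookkeeping] -/
theorem contribB_out (h1 : farB b = false) (h3 : decide (49 * (SC : ℤ) < (dot3 (vecB E X b) (vecB E X b)).lo) = true) :
    contribB en ed sn sd c w E E0 X X0 b = Acc.zero := by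
  unfold contribB; extract_lets V; rw [h1, h3]

/-- [formal bookkeeping] -/
theorem contribB_near (h1 : farB b = false) (h3 : decide (49 * (SC : ℤ) < (dot3 (vecB E X b) (vecB E X b)).lo) = false)
    (h4 : decide ((dot3 (vecB E X b) (vecB E X b)).hi ≤ near2) = true) :
    contribB en ed sn sd c w E E0 X X0 b = nearContrib en ed sn sd (vecB E0 X0 b) (vecB eId X0 b) (dB c w (vecB eId X0 b)) := by
  unfold contribB; extract_lets V; rw [h1, h3, h4]

/-- [formal bookkeeping] -/
theorem contribB_naive (h1 : farB b = false) (h3 : decide (49 * (SC : ℤ) < (dot3 (vecB E X b) (vecB E X b)).lo) = false)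
    (h4 : decide ((dot3 (vecB E X b) (vecB E X b)).hi ≤ near2) = false) :
    contribB en ed sn sd c w E E0 X X0 b = naiveContrib (termHi en ed sn sd false (vecB E X b)) := by
  unfold contribB; extract_lets V; rw [h1, h3, h4]

end caseEqs

/-! ## §2. Shared little facts -/

/-- `Acc.zero` carries the trivial coefficients. [formal bookkeeping] -/
theorem zero_sound (Λ : (Fin 3 × Fin 3 → ℝ) → (Fin 3 → ℝ) → ℝ) (hΛ0 : Λ 0 0 = 0) {x : ℝ} (hx : x = 0) :
    ∃ κ : Fin 3 × Fin 3 → ℝ, ∃ σ : Fin 3 → ℝ, (∀ ac, FI.mem (κ ac) (Acc.zero.K ac)) ∧ (∀ a, FI.mem (σ a) (Acc.zero.S a)) ∧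
      x * SC ≤ (Acc.zero.val : ℝ) + Acc.zero.nv + (Acc.zero.rem : ℝ) / 2 + SC * Λ κ σ := by
  refine ⟨0, 0, fun ac => ?_, fun a => ?_, ?_⟩
  · simpa [Acc.zero] using FI.mem_ofInt 0
  · simpa [Acc.zero] using FI.mem_ofInt 0
  · simp [Acc.zero, hΛ0, hx]

/-- `naiveContrib (some t)` with `x·SC ≤ t` carries the trivial coefficients. [formal bookkeeping] -/
theorem naive_sound (Λ : (Fin 3 × Fin 3 → ℝ) → (Fin 3 → ℝ) → ℝ) (hΛ0 : Λ 0 0 = 0) {x : ℝ} {t : ℤ} (hx : x * SC ≤ t) :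
    ∃ κ : Fin 3 × Fin 3 → ℝ, ∃ σ : Fin 3 → ℝ, (∀ ac, FI.mem (κ ac) ((naiveContrib (some t)).K ac)) ∧
      (∀ a, FI.mem (σ a) ((naiveContrib (some t)).S a)) ∧
      x * SC ≤ ((naiveContrib (some t)).val : ℝ) + (naiveContrib (some t)).nv + ((naiveContrib (some t)).rem : ℝ) / 2 + SC * Λ κ σ := by
  refine ⟨0, 0, fun ac => ?_, fun a => ?_, ?_⟩
  · simpa [naiveContrib] using FI.mem_ofInt 0
  · simpa [naiveContrib] using FI.mem_ofInt 0
  · simp [naiveContrib, hΛ0]; exact hx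

/-- The guard of `naiveContrib` certifies the enclosure. [formal bookkeeping] -/
theorem naive_ok {t : Option ℤ} (h : (naiveContrib t).ok = true) : ∃ z, t = some z := by
  cases t with
  | none => simp [naiveContrib, Acc.bad] at h
  | some z => exact ⟨z, rfl⟩

/-- The near guard gives `nv = 0`. [formal bookkeeping] -/
theorem nearContrib_nv {en : Fin 3 → ℤ} {ed : ℕ} {sn : ℤ} {sd : ℕ} {V0 q : Fin 3 → FI} {D : Fin 3 → ℤ}
    (hok : (nearContrib en ed sn sd V0 q D).ok = true) : (nearContrib en ed sn sd V0 q D).nv = 0 := by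
  obtain ⟨u0, uh, h0, hh⟩ := nearContrib_ok hok
  rw [nearContrib_of_some h0 hh]

/-- The cut slope term vanishes outside the `7`-ball. [formal bookkeeping] -/
theorem cutSlope_eq_zero_of_gt {v e : E3} {τ : ℝ} (h : 7 < ‖v‖) : cutSlope v e τ = 0 := by
  have : ¬(v ≠ 0 ∧ ‖v‖ ≤ 7) := fun hh => by linarith [hh.2]
  simp [cutSlope, this]

/-- Inside the ball and away from `0` the cut slope term IS the closed form of `…HomForceKit`. [formal bookkeeping] -/
theorem cutSlope_eq_closedForm {v e : E3} {τ : ℝ} (hne : v ≠ 0) (h7 : ‖v‖ ≤ 7) :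
    cutSlope v e τ = ((‖τ • e - v‖ ^ 2)⁻¹ ^ 4 - (‖τ • e - v‖ ^ 2)⁻¹ ^ 7) * (τ * ⟪e, e⟫ - ⟪v, e⟫) := by
  rw [closedForm_eq_kernel]; simp [cutSlope, hne, h7]

/-- Far `A` labels are outside the ball: `farA b ⟹ ‖U (P b)‖ > 7` for `‖U − 1‖ ≤ 1/4`. [folklore] -/
theorem norm_gt_of_farA {U : E3 →L[ℝ] E3} (hU : ‖U - 1‖ ≤ 1 / 4) {b : Fin 3 → ℤ} (h : farA b = true) : 7 < ‖latPt U hexFrame b‖ := by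
  have h' : (784 : ℤ) < 9 * (b 0 * b 0 + b 0 * b 1 + b 1 * b 1) + 24 * (b 2 * b 2) := by simpa [farA] using h
  have hr : (784 : ℝ) < 9 * ((b 0 : ℝ) * b 0 + (b 0 : ℝ) * b 1 + (b 1 : ℝ) * b 1) + 24 * ((b 2 : ℝ) * b 2) := by exact_mod_cast h'
  have hsq := norm_sq_hexPt b
  have hP : (28 / 3 : ℝ) < ‖latPt 1 hexFrame b‖ := by
    have hn := norm_nonneg (latPt 1 hexFrame b)
    nlinarith [hsq, hr, hn]
  rw [latPt_eq_apply_one]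
  have := norm_apply_ge_of_near_one hU (latPt 1 hexFrame b)
  linarith

/-- Far `B` labels are outside the ball: `farB b ⟹ ‖U (P b + t + ξ)‖ > 7` for `‖U − 1‖ ≤ 1/4`, `‖ξ‖ ≤ 1/4`. [folklore] -/
theorem norm_gt_of_farB {U : E3 →L[ℝ] E3} (hU : ‖U - 1‖ ≤ 1 / 4) {ξ : E3} (hξ : ‖ξ‖ ≤ 1 / 4) {b : Fin 3 → ℤ} (h : farB b = true) :
    7 < ‖latPt U hexFrame b + U (hcpShift + ξ)‖ := by
  have h' : (13225 : ℤ) < 4 * ((6 * b 0 + 3 * b 1 + 3) * (6 * b 0 + 3 * b 1 + 3) + 3 * ((3 * b 1 + 1) * (3 * b 1 + 1)) +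
      24 * ((2 * b 2 + 1) * (2 * b 2 + 1))) := by simpa [farB] using h
  have hr : (13225 : ℝ) < 4 * ((6 * (b 0 : ℝ) + 3 * b 1 + 3) * (6 * (b 0 : ℝ) + 3 * b 1 + 3) + 3 * ((3 * (b 1 : ℝ) + 1) * (3 * (b 1 : ℝ) + 1)) +
      24 * ((2 * (b 2 : ℝ) + 1) * (2 * (b 2 : ℝ) + 1))) := by exact_mod_cast h'
  have hsq := norm_sq_hexPt_add_shift b
  have hP : (115 / 12 : ℝ) < ‖latPt 1 hexFrame b + hcpShift‖ := by
    have hn := norm_nonneg (latPt 1 hexFrame b + hcpShift)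
    nlinarith [hsq, hr, hn]
  rw [shifted_eq_apply]
  have h1 := norm_apply_ge_of_near_one hU (latPt 1 hexFrame b + hcpShift + ξ)
  have h2 : ‖latPt 1 hexFrame b + hcpShift‖ ≤ ‖latPt 1 hexFrame b + hcpShift + ξ‖ + ‖ξ‖ := by
    have := norm_add_le (latPt 1 hexFrame b + hcpShift + ξ) (-ξ)
    simpa using this
  linarith

/-- Identity entries enclose the identity map. [formal bookkeeping] -/
theorem mem_eId (ab : Fin 3 × Fin 3) : FI.mem (((1 : E3 →L[ℝ] E3) (EuclideanSpace.single ab.2 (1 : ℝ))) ab.1) (eId ab) := by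
  obtain ⟨a, b⟩ := ab
  by_cases h : a = b
  · subst h
    simpa [eId] using FI.mem_ofInt 1
  · simpa [eId, h] using FI.mem_ofInt 0

/-- The centre entries are enclosed by the thin `cenE`. [formal bookkeeping] -/
theorem mem_cenE {c : (Fin 3 × Fin 3) ⊕ Fin 3 → ℤ} {U₀ : E3 →L[ℝ] E3}
    (hU₀ : ∀ ab : Fin 3 × Fin 3, (U₀ (EuclideanSpace.single ab.2 (1 : ℝ))) ab.1 = (c (Sum.inl ab) : ℝ) / SC) (ab : Fin 3 × Fin 3) :
    FI.mem ((U₀ (EuclideanSpace.single ab.2 (1 : ℝ))) ab.1) (cenE c ab) := by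
  unfold cenE
  refine mem_entryFI ?_
  rw [hU₀]; simp

/-- The centre shuffle is enclosed by the thin `cenX`. [formal bookkeeping] -/
theorem mem_cenX {c : (Fin 3 × Fin 3) ⊕ Fin 3 → ℤ} {ξ₀ : E3} (hξ₀ : ∀ i, ξ₀ i = (c (Sum.inr i) : ℝ) / SC) (i : Fin 3) : FI.mem (ξ₀ i) (cenX c i) := by
  unfold cenX
  refine mem_shufFI ?_
  rw [hξ₀]; simp

/-- Box hypotheses give nonnegative half-widths. [formal bookkeeping] -/
theorem w_nonneg_of_box {x cc : ℝ} {ww : ℤ} (h : |x - cc / SC| ≤ (ww : ℝ) / SC) : (0 : ℝ) ≤ ww := by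
  have hS := SC_pos
  have := (abs_nonneg _).trans h
  exact_mod_cast (div_nonneg_iff.1 this).elim (fun h => h.1) (fun h => absurd h.2 (not_le.2 hS))

/-! ## §3. ★★ The `A`-family per-label lemma -/

/-- ★★ **`A`-FAMILY PER-LABEL SOUNDNESS.**  See the module docstring (`Λ_A κ σ = Σ_ac Δu_ac κ_ac`). [folklore] -/
theorem contribA_sound {en : Fin 3 → ℤ} {ed : ℕ} (hed : 0 < ed) {sn : ℤ} {sd : ℕ} (hsd : 0 < sd) {τ : ℝ} (h0 : 0 ≤ τ)
    (hs : τ ≤ (sn : ℝ) / sd) {c w : (Fin 3 × Fin 3) ⊕ Fin 3 → ℤ} {U U₀ : E3 →L[ℝ] E3} (hU : ‖U - 1‖ ≤ 1 / 4)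
    (hbox : ∀ ab : Fin 3 × Fin 3, |(U (EuclideanSpace.single ab.2 (1 : ℝ))) ab.1 - (c (Sum.inl ab) : ℝ) / SC| ≤ (w (Sum.inl ab) : ℝ) / SC)
    (hU₀ : ∀ ab : Fin 3 × Fin 3, (U₀ (EuclideanSpace.single ab.2 (1 : ℝ))) ab.1 = (c (Sum.inl ab) : ℝ) / SC) (b : Fin 3 → ℤ)
    (hok : (contribA en ed sn sd w (boxE c w) (cenE c) b).ok = true) :
    ∃ κ : Fin 3 × Fin 3 → ℝ, ∃ σ : Fin 3 → ℝ,
      (∀ ac, FI.mem (κ ac) ((contribA en ed sn sd w (boxE c w) (cenE c) b).K ac)) ∧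
      (∀ a, FI.mem (σ a) ((contribA en ed sn sd w (boxE c w) (cenE c) b).S a)) ∧
      cutSlope (latPt U hexFrame b) (dirVec en ed) τ * SC ≤
        ((contribA en ed sn sd w (boxE c w) (cenE c) b).val : ℝ) + (contribA en ed sn sd w (boxE c w) (cenE c) b).nv +
          ((contribA en ed sn sd w (boxE c w) (cenE c) b).rem : ℝ) / 2 +
          SC * ∑ ac : Fin 3 × Fin 3, ((U (EuclideanSpace.single ac.2 (1 : ℝ))) ac.1 - (c (Sum.inl ac) : ℝ) / SC) * κ ac := by
  have hS := SC_pos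
  have hEm : ∀ ab : Fin 3 × Fin 3, FI.mem ((U (EuclideanSpace.single ab.2 (1 : ℝ))) ab.1) (boxE c w ab) := fun ab => mem_entryFI (hbox ab)
  have hE0m : ∀ ab : Fin 3 × Fin 3, FI.mem ((U₀ (EuclideanSpace.single ab.2 (1 : ℝ))) ab.1) (cenE c ab) := mem_cenE hU₀
  have hvV : ∀ a, FI.mem ((latPt U hexFrame b) a) (vecA (boxE c w) b a) := mem_vecA U hEm b
  have hΛ0 : (∑ ac : Fin 3 × Fin 3, ((U (EuclideanSpace.single ac.2 (1 : ℝ))) ac.1 - (c (Sum.inl ac) : ℝ) / SC) * (0 : Fin 3 × Fin 3 → ℝ) ac) = 0 := by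
    simp
  obtain ⟨o1, h1⟩ : ∃ o, farA b = o := ⟨_, rfl⟩
  cases o1 with
  | true =>
    rw [contribA_far h1]
    exact zero_sound (fun κ _ => ∑ ac : Fin 3 × Fin 3, ((U (EuclideanSpace.single ac.2 (1 : ℝ))) ac.1 - (c (Sum.inl ac) : ℝ) / SC) * κ ac) hΛ0
      (cutSlope_eq_zero_of_gt (norm_gt_of_farA hU h1))
  | false =>
  obtain ⟨o2, h2⟩ : ∃ o, decide (b = 0) = o := ⟨_, rfl⟩
  cases o2 with
  | true =>
    rw [contribA_zero h1 h2]
    have hb : b = 0 := of_decide_eq_true h2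
    refine zero_sound (fun κ _ => ∑ ac : Fin 3 × Fin 3, ((U (EuclideanSpace.single ac.2 (1 : ℝ))) ac.1 - (c (Sum.inl ac) : ℝ) / SC) * κ ac) hΛ0 ?_
    rw [hb, latPt_zero]
    simp [cutSlope]
  | false =>
  have hb : b ≠ 0 := of_decide_eq_false h2
  have hne : latPt U hexFrame b ≠ 0 := fun h => hb (latPt_hex_injective hU (by rw [h, latPt_zero]))
  have hQ : FI.mem (‖latPt U hexFrame b‖ ^ 2) (dot3 (vecA (boxE c w) b) (vecA (boxE c w) b)) := by
    rw [← real_inner_self_eq_norm_sq]; exact mem_dot3 hvV hvV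
  obtain ⟨o3, h3⟩ : ∃ o, decide (49 * (SC : ℤ) < (dot3 (vecA (boxE c w) b) (vecA (boxE c w) b)).lo) = o := ⟨_, rfl⟩
  cases o3 with
  | true =>
    rw [contribA_out h1 h2 h3]
    refine zero_sound (fun κ _ => ∑ ac : Fin 3 × Fin 3, ((U (EuclideanSpace.single ac.2 (1 : ℝ))) ac.1 - (c (Sum.inl ac) : ℝ) / SC) * κ ac) hΛ0
      (cutSlope_eq_zero_of_gt ?_)
    have hlt : 49 * (SC : ℤ) < (dot3 (vecA (boxE c w) b) (vecA (boxE c w) b)).lo := of_decide_eq_true h3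
    have h1' := (FI.mem_def.1 hQ).1
    have hlt' : (49 : ℝ) * SC < ((dot3 (vecA (boxE c w) b) (vecA (boxE c w) b)).lo : ℝ) := by exact_mod_cast hlt
    have h49 : (49 : ℝ) < ‖latPt U hexFrame b‖ ^ 2 := by nlinarith
    nlinarith [norm_nonneg (latPt U hexFrame b)]
  | false =>
  obtain ⟨o4, h4⟩ : ∃ o, decide ((dot3 (vecA (boxE c w) b) (vecA (boxE c w) b)).hi ≤ near2) = o := ⟨_, rfl⟩
  cases o4 with
  | false =>
    rw [contribA_naive h1 h2 h3 h4] at hok ⊢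
    obtain ⟨t, ht⟩ := naive_ok hok
    rw [ht]
    refine naive_sound (fun κ _ => ∑ ac : Fin 3 × Fin 3, ((U (EuclideanSpace.single ac.2 (1 : ℝ))) ac.1 - (c (Sum.inl ac) : ℝ) / SC) * κ ac) hΛ0 ?_
    exact cutSlope_le_termHi hed hsd h0 hs hvV (skip := false) (fun h => absurd h (by simp)) (fun _ => hne) ht
  | true =>
    rw [contribA_near h1 h2 h3 h4] at hok ⊢
    have h7 : ‖latPt U hexFrame b‖ ≤ 7 := by
      have hle : (dot3 (vecA (boxE c w) b) (vecA (boxE c w) b)).hi ≤ near2 := of_decide_eq_true h4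
      have h2' := (FI.mem_def.1 hQ).2
      have hle' : ((dot3 (vecA (boxE c w) b) (vecA (boxE c w) b)).hi : ℝ) ≤ ((near2 : ℤ) : ℝ) := by exact_mod_cast hle
      have hn2 : ((near2 : ℤ) : ℝ) ≤ 25 / 4 * SC := by
        have h' : ((25 * (SC : ℤ) / 4 : ℤ) : ℝ) * 4 ≤ ((25 * (SC : ℤ) : ℤ) : ℝ) := by exact_mod_cast Int.ediv_mul_le (25 * (SC : ℤ)) (by norm_num : (4 : ℤ) ≠ 0)
        unfold near2
        push_cast at h' ⊢
        linarith
      have hsq : ‖latPt U hexFrame b‖ ^ 2 ≤ 7 ^ 2 := by nlinarith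
      exact (abs_le_of_sq_le_sq' hsq (by norm_num)).2
    have hv0V : ∀ a, FI.mem ((latPt U₀ hexFrame b) a) (vecA (cenE c) b a) := mem_vecA U₀ hE0m b
    have hq : ∀ a, FI.mem ((latPt 1 hexFrame b) a) (vecA eId b a) := mem_vecA 1 mem_eId b
    have hdiff : ∀ a, (latPt U hexFrame b) a - (latPt U₀ hexFrame b) a =
        ∑ cc : Fin 3, ((U (EuclideanSpace.single cc (1 : ℝ))) a - (U₀ (EuclideanSpace.single cc (1 : ℝ))) a) * (latPt 1 hexFrame b) cc := by
      intro a
      rw [latPt_eq_apply_one U, latPt_eq_apply_one U₀, apply_eq_sum_entries U, apply_eq_sum_entries U₀, ← Finset.sum_sub_distrib]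
      exact Finset.sum_congr rfl fun cc _ => by ring
    have hterm : ∀ a cc : Fin 3, |((U (EuclideanSpace.single cc (1 : ℝ))) a - (U₀ (EuclideanSpace.single cc (1 : ℝ))) a) *
        (latPt 1 hexFrame b) cc| * SC ≤ (w (Sum.inl (a, cc)) : ℝ) * (FI.absHi (vecA eId b cc) : ℝ) / SC := by
      intro a cc
      have hu : |(U (EuclideanSpace.single cc (1 : ℝ))) a - (U₀ (EuclideanSpace.single cc (1 : ℝ))) a| ≤ (w (Sum.inl (a, cc)) : ℝ) / SC := by
        rw [hU₀ (a, cc)]; exact hbox (a, cc)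
      have hp := FI.abs_le_absHi (hq cc)
      have hw : (0 : ℝ) ≤ (w (Sum.inl (a, cc)) : ℝ) / SC := le_trans (abs_nonneg _) hu
      calc |((U (EuclideanSpace.single cc (1 : ℝ))) a - (U₀ (EuclideanSpace.single cc (1 : ℝ))) a) * (latPt 1 hexFrame b) cc| * SC
          = |(U (EuclideanSpace.single cc (1 : ℝ))) a - (U₀ (EuclideanSpace.single cc (1 : ℝ))) a| * (|(latPt 1 hexFrame b) cc| * SC) := by
            rw [abs_mul]; ring
        _ ≤ (w (Sum.inl (a, cc)) : ℝ) / SC * (FI.absHi (vecA eId b cc) : ℝ) := mul_le_mul hu hp (by positivity) hw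
        _ = (w (Sum.inl (a, cc)) : ℝ) * (FI.absHi (vecA eId b cc) : ℝ) / SC := by ring
    have hD : ∀ a, |(latPt U hexFrame b) a - (latPt U₀ hexFrame b) a| * SC ≤ (dA w (vecA eId b) a : ℝ) := by
      intro a
      have hc := div_le_cdiv (a := w (Sum.inl (a, 0)) * FI.absHi (vecA eId b 0) + w (Sum.inl (a, 1)) * FI.absHi (vecA eId b 1) +
        w (Sum.inl (a, 2)) * FI.absHi (vecA eId b 2)) (b := SC) SCZ_pos
      push_cast at hc
      unfold dA
      push_cast
      refine le_trans ?_ hc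
      rw [hdiff a, Fin.sum_univ_three]
      have htri := mul_le_mul_of_nonneg_right (abs_add_three
        (((U (EuclideanSpace.single 0 (1 : ℝ))) a - (U₀ (EuclideanSpace.single 0 (1 : ℝ))) a) * (latPt 1 hexFrame b) 0)
        (((U (EuclideanSpace.single 1 (1 : ℝ))) a - (U₀ (EuclideanSpace.single 1 (1 : ℝ))) a) * (latPt 1 hexFrame b) 1)
        (((U (EuclideanSpace.single 2 (1 : ℝ))) a - (U₀ (EuclideanSpace.single 2 (1 : ℝ))) a) * (latPt 1 hexFrame b) 2)) hS.le
      rw [add_div, add_div]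
      linarith [hterm a 0, hterm a 1, hterm a 2, htri]
    obtain ⟨W, hWK, hWS, hmain⟩ := nearContrib_sound hed hsd h0 hs (v := latPt U hexFrame b) (v0 := latPt U₀ hexFrame b) hv0V hq hD hok
    refine ⟨fun ac => W ac.1 * (latPt 1 hexFrame b) ac.2, W, hWK, hWS, ?_⟩
    rw [cutSlope_eq_closedForm hne h7, nearContrib_nv hok]
    have hΛ : (∑ ac : Fin 3 × Fin 3, ((U (EuclideanSpace.single ac.2 (1 : ℝ))) ac.1 - (c (Sum.inl ac) : ℝ) / SC) *
        (fun ac : Fin 3 × Fin 3 => W ac.1 * (latPt 1 hexFrame b) ac.2) ac) =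
        ∑ a : Fin 3, W a * ((latPt U hexFrame b) a - (latPt U₀ hexFrame b) a) := by
      rw [Fintype.sum_prod_type]
      refine Finset.sum_congr rfl fun a _ => ?_
      rw [hdiff a, Finset.mul_sum]
      refine Finset.sum_congr rfl fun cc _ => ?_
      rw [hU₀ (a, cc)]
      ring
    rw [hΛ]
    push_cast
    linarith [hmain]

end Summit.AtomisticToContinuum.Crystallization.Theorems.FrustratedLawDichotomyStrainedPatchHomForceCentredLeaf
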